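import Literature.NumberTheory.Automorphic.QuaternionUnitsTraceClasses
import Literature.MeasureTheory.Group.InvariantQuotientTransport
import HarnessLib

/-!
# The central classes of the `D^×` trace formula: `vol(G_γ ⧸ H_γ) ∫_{G/G_γ} Φ(y γ y⁻¹) =
# vol(D_𝔸ˣ ⧸ ℝ_{>0} Dˣ) · Φ(γ)` for `γ ∈ Kˣ`
(Gelbart, *Automorphic forms on adele groups* (1975), (10.14)–(10.15), p. 154: the terms
`meas(Z'_𝔸 G'_F \ G'_𝔸) Φ'(e)` and `meas(Z_𝔸 G_F \ G_𝔸) Φ(e)`)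

Topic `NumberTheory/Automorphic` (with a short `Literature.MeasureTheory.Group` section of general
lemmas); one definition (`centralizerEquivOfEqAlgebraMap`, the identification `C_{D_𝔸ˣ}(γ) ≃* D_𝔸ˣ`
for central `γ`), theorems otherwise; no named fact, no instance. Continuation of
`QuaternionUnitsTraceNormalized`, whose trace formula
`Σ_i ‖R(f) e_i‖² = Σ'_c vol(G_c ⧸ H_c) ∫_{G ⧸ G_c} (f ⋆ f^*)_A(y γ_c y⁻¹) d(ν/ν_c)` carries, for each
class `c`, an auxiliary Haar measure `ν_c` on the centraliser `G_c` (cancelling between the two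
factors). For the **central** classes `γ_c ∈ Kˣ` (where `G_c = D_𝔸ˣ`, `H_c = ℝ_{>0} Dˣ` and
`G ⧸ G_c` is a point) this file makes the cancellation explicit and identifies the term with the
printed one:

* general lemmas (`Literature.MeasureTheory.Group`): for `H₀ = G`, the orbital integral of a
  central element over the point `G ⧸ H₀` is `F(γ) · μ(pt)` (`lintegral_descConj_of_eq_top`); the
  quotient measure of the point has mass the Haar scalar factor `c`, `ν = c • val_* ν₀`
  (`quotientMeasure_univ_of_eq_top`, testing Weil's formula with constant one); and **the quotient
  measure is homogeneous in `ν`**, `ν₁ = c • ν₂ ⟹ ν₁/ρ = c • (ν₂/ρ)`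
  (`quotientMeasure_eq_smul_of_eq_smul`);
* `units_integral_descConj_of_eq_algebraMap`, `units_quotientMeasure_centralizer_univ_of_eq_algebraMap`,
  `units_restricted_eq_map_of_eq_algebraMap` — the three factors of a central term of the `D^×`
  formula in terms of `ν_c` viewed on `D_𝔸ˣ`;
* `units_centralTerm_eq` — **the central term equals `vol(D_𝔸ˣ ⧸ ℝ_{>0} Dˣ; ν, ρ₀) · Φ(γ)`**, the
  covolume of `ℝ_{>0} Dˣ` for the Haar measures `ν` of `D_𝔸ˣ` and `ρ₀` of `ℝ_{>0} Dˣ` (total mass of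
  `quotientMeasure L ρ₀ ν`, Weil constant one) times the value at `γ`, independently of `ν_c`
  (naturality of the quotient measure, `InvariantQuotientTransport`, and homogeneity). With
  `Φ = (f ⋆ f^*)_A` and `ρ₀ = α ⊗ counting` this is Gelbart's `meas(Z_𝔸 G_F \ G_𝔸) Φ(e)`-term, one for
  each `γ ∈ Kˣ` since no central character is fixed here.

Part of the inline (D-0026) decomposition of
`Literature.NumberTheory.Automorphic.strong_multiplicity_one_quaternionUnits` (Gelbart Thm. 10.5).
The regular (elliptic) classes are treated in `QuaternionTorusCentralizer` (volume = covolume of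
`ℝ_{>0} K(γ)ˣ` in `K(γ)_𝔸ˣ`).

## References

* S. Gelbart, *Automorphic forms on adele groups*, Ann. of Math. Studies 83 (1975), (10.14)–(10.15)
  and p. 154 [Gelbart1975].
-/

noncomputable section

open _root_.MeasureTheory _root_.MeasureTheory.Measure _root_.Topology Set Filter Function
open scoped ENNReal NNReal Pointwise

attribute [-instance] Quotient.instMeasurableSpace QuotientGroup.measurableSpace

namespace Literature.MeasureTheory.Group

/-! ### Coset spaces by the whole group: the point `G ⧸ G` -/

section Top

variable {G : Type*} [Group G] [TopologicalSpace G] [IsTopologicalGroup G] [LocallyCompactSpace G]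
  [SecondCountableTopology G] [T2Space G] [MeasurableSpace G] [BorelSpace G]
  (H₀ : Subgroup G) (hH₀ : H₀ = ⊤)

include hH₀ in
omit [TopologicalSpace G] [IsTopologicalGroup G] [LocallyCompactSpace G] [SecondCountableTopology G]
  [T2Space G] [MeasurableSpace G] [BorelSpace G] in
/-- `G ⧸ G` is a point: every coset is the coset of `1`. [folklore] -/
theorem quotient_mk_eq_mk_one_of_eq_top (g : G) :
    (QuotientGroup.mk g : G ⧸ H₀) = QuotientGroup.mk 1 :=
  QuotientGroup.eq.2 (by rw [hH₀]; exact Subgroup.mem_top _)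

omit [TopologicalSpace G] [IsTopologicalGroup G] [LocallyCompactSpace G] [SecondCountableTopology G]
  [T2Space G] [MeasurableSpace G] [BorelSpace G] in
/-- **The orbital integral of a central element over the point `G ⧸ G`**: for `γ` central,
`H₀ = G` and any measure `μ` on `G ⧸ H₀`, `∫⁻ F(y γ y⁻¹) dμ(y) = F(γ) · μ(G ⧸ G)`. [folklore] -/
theorem lintegral_descConj_of_eq_top [MeasurableSpace (G ⧸ H₀)] {γ : G}
    (hγ : γ ∈ Subgroup.center G) (hc : ∀ g ∈ H₀, g * γ = γ * g) (F : G → ℝ≥0∞)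
    (μ : Measure (G ⧸ H₀)) :
    ∫⁻ y, descConj γ H₀ hc F y ∂μ = F γ * μ Set.univ := by
  have h : ∀ y : G ⧸ H₀, descConj γ H₀ hc F y = F γ := by
    intro y
    induction y using QuotientGroup.induction_on with
    | H g =>
      rw [descConj_mk, Subgroup.mem_center_iff.1 hγ g, mul_inv_cancel_right]
  simp_rw [h]
  rw [lintegral_const]

variable [hc₀ : IsClosed (H₀ : Set G)] [MeasurableSpace (G ⧸ H₀)] [BorelSpace (G ⧸ H₀)]
  (ν₀ : Measure H₀) [ν₀.IsMulLeftInvariant] [IsFiniteMeasureOnCompacts ν₀] [ν₀.IsOpenPosMeasure]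
  [ν₀.IsInvInvariant] [SFinite ν₀]
  (ν : Measure G) [IsHaarMeasure ν] [ν.IsMulRightInvariant]
  (ν' : Measure G) [IsHaarMeasure ν']

include hH₀ in
omit [LocallyCompactSpace G] [SecondCountableTopology G] [T2Space G] hc₀ [MeasurableSpace (G ⧸ H₀)]
  [BorelSpace (G ⧸ H₀)] [IsFiniteMeasureOnCompacts ν₀] [ν₀.IsOpenPosMeasure] [ν₀.IsInvInvariant]
  [SFinite ν₀] [IsHaarMeasure ν'] in
/-- For `H₀ = G`, the fibre integral is the integral over `G` against the image of `ν₀`: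
`∫⁻_{H₀} f(x h) dν₀(h) = ∫⁻_G f dν'`, `ν' = val_* ν₀`. [folklore] -/
theorem fiberLIntegral_of_eq_top (hν' : ν' = Measure.map ((↑) : H₀ → G) ν₀) (f : G → ℝ≥0∞)
    (x : G) : fiberLIntegral H₀ ν₀ f (QuotientGroup.mk x) = ∫⁻ g, f g ∂ν' := by
  have hx : x ∈ H₀ := by rw [hH₀]; exact Subgroup.mem_top x
  have hm : MeasurableSet (H₀ : Set G) := by rw [hH₀, Subgroup.coe_top]; exact MeasurableSet.univ
  have hme : MeasurableEmbedding (Subtype.val : H₀ → G) := MeasurableEmbedding.subtype_coe hm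
  rw [fiberLIntegral_mk, hν', hme.lintegral_map]
  have h := lintegral_mul_left_eq_self (μ := ν₀) (fun h : H₀ => f (h : G)) ⟨x, hx⟩
  simpa only [Subgroup.coe_mul] using h

include hH₀ in
/-- **The mass of the point `G ⧸ G`**: for `H₀ = G` with a Haar-type measure `ν₀` on `H₀` and a
Haar measure `ν` on `G`, the quotient measure (Weil constant one) of the one-point space has total
mass the Haar scalar factor of `ν` relative to `ν' = val_* ν₀`: `(ν/ν₀)(G ⧸ G) = c` where
`ν = c • ν'` (test Weil's formula on a `g ∈ C_c(G)`). [folklore] -/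
theorem quotientMeasure_univ_of_eq_top (hν' : ν' = Measure.map ((↑) : H₀ → G) ν₀) :
    quotientMeasure H₀ ν₀ hc₀ ν Set.univ = haarScalarFactor ν ν' := by
  obtain ⟨g, hgs, hg0, hg1⟩ := exists_continuous_nonneg_pos (1 : G)
  have hgm : Measurable fun a => ENNReal.ofReal (g a) := ENNReal.measurable_ofReal.comp g.continuous.measurable
  -- Weil with constant one, for `ofReal ∘ g`
  have hW := lintegral_fiberLIntegral_quotientMeasure H₀ ν₀ ν hgm
  have hfib : ∀ y : G ⧸ H₀, fiberLIntegral H₀ ν₀ (fun a => ENNReal.ofReal (g a)) y =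
      ∫⁻ a, ENNReal.ofReal (g a) ∂ν' := by
    intro y
    induction y using QuotientGroup.induction_on with
    | H x => exact fiberLIntegral_of_eq_top H₀ hH₀ ν₀ ν' hν' _ x
  simp_rw [hfib] at hW
  rw [lintegral_const] at hW
  -- the two integrals of `g` are positive and finite, and `∫ g dν = c ∫ g dν'`
  have hI' : ∫⁻ a, ENNReal.ofReal (g a) ∂ν' = ENNReal.ofReal (∫ a, g a ∂ν') :=
    (ofReal_integral_eq_lintegral_ofReal (g.continuous.integrable_of_hasCompactSupport hgs)
      (Eventually.of_forall hg0)).symm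
  have hI : ∫⁻ a, ENNReal.ofReal (g a) ∂ν = ENNReal.ofReal (∫ a, g a ∂ν) :=
    (ofReal_integral_eq_lintegral_ofReal (g.continuous.integrable_of_hasCompactSupport hgs)
      (Eventually.of_forall hg0)).symm
  have hpos' : 0 < ∫ a, g a ∂ν' :=
    g.continuous.integral_pos_of_hasCompactSupport_nonneg_nonzero hgs hg0 hg1
  have hsmul : ∫ a, g a ∂ν = haarScalarFactor ν ν' * ∫ a, g a ∂ν' := by
    rw [integral_isMulLeftInvariant_eq_smul_of_hasCompactSupport ν ν' g.continuous hgs,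
      integral_smul_nnreal_measure, NNReal.smul_def, smul_eq_mul]
  rw [hI', hI, hsmul, ENNReal.ofReal_mul (NNReal.coe_nonneg _), ENNReal.ofReal_coe_nnreal,
    mul_comm] at hW
  exact (ENNReal.mul_left_inj ((ENNReal.ofReal_pos.2 hpos').ne') ENNReal.ofReal_ne_top).1 hW

end Top

/-! ### The quotient measure is homogeneous in `ν` -/

section Smul

variable {G : Type*} [Group G] [TopologicalSpace G] [IsTopologicalGroup G] [LocallyCompactSpace G]
  [SecondCountableTopology G] [T2Space G] [MeasurableSpace G] [BorelSpace G]
  (H : Subgroup G) [hH : IsClosed (H : Set G)] [MeasurableSpace (G ⧸ H)] [BorelSpace (G ⧸ H)]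
  (ρ : Measure H) [ρ.IsMulLeftInvariant] [IsFiniteMeasureOnCompacts ρ] [ρ.IsOpenPosMeasure]
  [ρ.IsInvInvariant] [SFinite ρ]
  (ν₁ : Measure G) [IsHaarMeasure ν₁] [ν₁.IsMulRightInvariant]
  (ν₂ : Measure G) [IsHaarMeasure ν₂] [ν₂.IsMulRightInvariant]

/-- **The quotient measure is homogeneous in the Haar measure of `G`**: if `ν₁ = c • ν₂` then
`ν₁/ρ = c • (ν₂/ρ)` (both sides are invariant with lift `ν₁`; uniqueness,
`eq_unfoldingConstant_smul_quotientMeasure`). [folklore] -/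
theorem quotientMeasure_eq_smul_of_eq_smul {c : ℝ≥0} (h : ν₁ = c • ν₂) :
    quotientMeasure H ρ hH ν₁ = c • quotientMeasure H ρ hH ν₂ := by
  have h1 := eq_unfoldingConstant_smul_quotientMeasure H ρ ν₂ (quotientMeasure H ρ hH ν₁)
  have hc : unfoldingConstant H ρ (quotientMeasure H ρ hH ν₁) ν₂ = c := by
    obtain ⟨g, hgs, hg0, hg1⟩ := exists_continuous_nonneg_pos (1 : G)
    have hgi : ∫ x, g x ∂ν₂ ≠ 0 :=
      (g.continuous.integral_pos_of_hasCompactSupport_nonneg_nonzero hgs hg0 hg1).ne'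
    unfold unfoldingConstant
    apply NNReal.coe_injective
    rw [haarScalarFactor_eq_integral_div_of_continuous_nonneg_pos _ ν₂ ⟨hgs, hg0, hg1⟩,
      liftMeasure_quotientMeasure H ρ ν₁, h, integral_smul_nnreal_measure, NNReal.smul_def,
      smul_eq_mul, mul_div_assoc, div_self hgi, mul_one]
  rw [hc] at h1
  exact h1

end Smul

end Literature.MeasureTheory.Group

open NumberField IsDedekindDomain MeasureTheory Measure Topology
open Literature.MeasureTheory.Group
open scoped NNReal ENNReal TensorProduct Pointwise

namespace Literature.NumberTheory.Automorphic

universe u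

/-! ### The central classes of the `D^×` trace formula -/

section Central

variable (K : Type) [Field K] [NumberField K] (D : Type u) [Ring D] [Algebra K D]
  [IsQuaternionAlgebra K D]

local notation "GD" => AdelicGroupData.units K D

/-- For a central `γ ∈ Kˣ ⊆ Dˣ`, the identification `C_{D_𝔸ˣ}(γ) = D_𝔸ˣ` as an isomorphism of
topological groups `C_{D_𝔸ˣ}(γ) ≃* D_𝔸ˣ` (underlying map the inclusion). [folklore] -/
def centralizerEquivOfEqAlgebraMap {d : Dˣ} {c : K} (hd : (d : D) = algebraMap K D c) :
    Subgroup.centralizer ({(GD).toAdelic d} : Set (GD).Adelic) ≃* (GD).Adelic :=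
  (MulEquiv.subgroupCongr (units_centralizer_eq_top_of_eq_algebraMap K D hd)).trans Subgroup.topEquiv

/-- The underlying map of `centralizerEquivOfEqAlgebraMap` is the inclusion (definitional).
[folklore] -/
@[simp]
theorem centralizerEquivOfEqAlgebraMap_apply {d : Dˣ} {c : K} (hd : (d : D) = algebraMap K D c)
    (x : Subgroup.centralizer ({(GD).toAdelic d} : Set (GD).Adelic)) :
    centralizerEquivOfEqAlgebraMap K D hd x = (x : (GD).Adelic) := rfl

/-- `centralizerEquivOfEqAlgebraMap` is continuous (it is the inclusion). [folklore] -/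
theorem continuous_centralizerEquivOfEqAlgebraMap {d : Dˣ} {c : K} (hd : (d : D) = algebraMap K D c) :
    Continuous (centralizerEquivOfEqAlgebraMap K D hd) := continuous_subtype_val

/-- The inverse of `centralizerEquivOfEqAlgebraMap` is continuous. [folklore] -/
theorem continuous_centralizerEquivOfEqAlgebraMap_symm {d : Dˣ} {c : K}
    (hd : (d : D) = algebraMap K D c) :
    Continuous (centralizerEquivOfEqAlgebraMap K D hd).symm :=
  Continuous.subtype_mk continuous_id _

variable [MeasurableSpace (AdelicGroupData.units K D).Adelic] [BorelSpace (AdelicGroupData.units K D).Adelic]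

attribute [local instance] AdelicGroupData.measurableSpaceQuotientForm
  AdelicGroupData.borelSpaceQuotientForm

omit [MeasurableSpace (AdelicGroupData.units K D).Adelic] [BorelSpace (AdelicGroupData.units K D).Adelic] in
/-- **The orbital integral of a central class is evaluation**: for central `γ = d ∈ Kˣ` and any
finite measure `μ` on the point `D_𝔸ˣ ⧸ C_{D_𝔸ˣ}(γ)`, `∫ Φ(y γ y⁻¹) dμ(y) = μ(pt) · Φ(γ)`.
[cite: Gelbart1975, (10.14) and p. 154] -/
theorem units_integral_descConj_of_eq_algebraMap {d : Dˣ} {c : K} (hd : (d : D) = algebraMap K D c)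
    [MeasurableSpace ((GD).Adelic ⧸ Subgroup.centralizer ({(GD).toAdelic d} : Set (GD).Adelic))]
    (μ : Measure ((GD).Adelic ⧸ Subgroup.centralizer ({(GD).toAdelic d} : Set (GD).Adelic)))
    (Φ : (GD).Adelic → ℂ) :
    ∫ y, descConj ((GD).toAdelic d) (Subgroup.centralizer ({(GD).toAdelic d} : Set (GD).Adelic))
        (mem_centralizer_singleton_comm _) Φ y ∂μ = (μ Set.univ).toReal • Φ ((GD).toAdelic d) := by
  have hγ : (GD).toAdelic d ∈ Subgroup.center (GD).Adelic := inclAdelic_mem_center_of_eq_algebraMap K D hd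
  have h : ∀ y, descConj ((GD).toAdelic d) (Subgroup.centralizer ({(GD).toAdelic d} :
      Set (GD).Adelic)) (mem_centralizer_singleton_comm _) Φ y = Φ ((GD).toAdelic d) := by
    intro y
    induction y using QuotientGroup.induction_on with
    | H g => rw [descConj_mk, Subgroup.mem_center_iff.1 hγ g, mul_inv_cancel_right]
  simp_rw [h]
  rw [integral_const, measureReal_def]

variable [LocallyCompactSpace (AdelicGroupData.units K D).Adelic]
  [SecondCountableTopology (AdelicGroupData.units K D).Adelic] [T2Space (AdelicGroupData.units K D).Adelic]

/-- **The mass of the point `D_𝔸ˣ ⧸ C(γ)` for central `γ`** is the Haar scalar factor of `ν`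
relative to the Haar measure `ν_γ` of `C(γ) = D_𝔸ˣ` viewed on `D_𝔸ˣ`:
`(ν/ν_γ)(pt) = c` where `ν = c • ν_γ` (`quotientMeasure_univ_of_eq_top`). [folklore] -/
theorem units_quotientMeasure_centralizer_univ_of_eq_algebraMap {d : Dˣ} {c : K}
    (hd : (d : D) = algebraMap K D c)
    [hCcl : IsClosed ((Subgroup.centralizer ({(GD).toAdelic d} : Set (GD).Adelic) :
      Subgroup (GD).Adelic) : Set (GD).Adelic)]
    [MeasurableSpace ((GD).Adelic ⧸ Subgroup.centralizer ({(GD).toAdelic d} : Set (GD).Adelic))]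
    [BorelSpace ((GD).Adelic ⧸ Subgroup.centralizer ({(GD).toAdelic d} : Set (GD).Adelic))]
    (νC : Measure (Subgroup.centralizer ({(GD).toAdelic d} : Set (GD).Adelic)))
    [νC.IsMulLeftInvariant] [IsFiniteMeasureOnCompacts νC] [νC.IsOpenPosMeasure] [νC.IsInvInvariant]
    [SFinite νC]
    (ν : Measure (GD).Adelic) [IsHaarMeasure ν] [ν.IsMulRightInvariant]
    (ν' : Measure (GD).Adelic) [IsHaarMeasure ν']
    (hν' : ν' = Measure.map (centralizerEquivOfEqAlgebraMap K D hd) νC) :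
    quotientMeasure (Subgroup.centralizer ({(GD).toAdelic d} : Set (GD).Adelic)) νC hCcl ν Set.univ =
      haarScalarFactor ν ν' :=
  quotientMeasure_univ_of_eq_top _ (units_centralizer_eq_top_of_eq_algebraMap K D hd) νC ν ν' hν'

omit [LocallyCompactSpace (AdelicGroupData.units K D).Adelic]
  [SecondCountableTopology (AdelicGroupData.units K D).Adelic] in
/-- **The restricted fibre measure of a central class is the transport of the Haar measure of
`L = ℝ_{>0} Dˣ`**: for central `γ`, `H_γ = L ∩ C(γ) = L`, and the measure
`ρ_F = ((ρ₀|_{L ∩ C(γ)}))^{transported to H_γ ≤ C(γ)}` of the trace formula is the image of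
`ρ₀` under the restriction `L ≃ H_γ` of `centralizerEquivOfEqAlgebraMap⁻¹`. [folklore] -/
theorem units_restricted_eq_map_of_eq_algebraMap {d : Dˣ} {c : K} (hd : (d : D) = algebraMap K D c)
    [hH : IsClosed ((GD).quotientSubgroup : Set (GD).Adelic)]
    (ρ₀ : Measure (GD).quotientSubgroup)
    (ρH : Measure ↥((GD).quotientSubgroup ⊓ Subgroup.centralizer ({(GD).toAdelic d} : Set (GD).Adelic)))
    (ρF : Measure ↥(((GD).quotientSubgroup ⊓ Subgroup.centralizer ({(GD).toAdelic d} :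
      Set (GD).Adelic)).subgroupOf (Subgroup.centralizer ({(GD).toAdelic d} : Set (GD).Adelic))))
    (hρH : ρH = ρ₀.comap (Subgroup.inclusion inf_le_left))
    (hρF : ρF = Measure.map (Subgroup.subgroupOfEquivOfLe inf_le_right).symm ρH)
    (hmem : ∀ g, (centralizerEquivOfEqAlgebraMap K D hd).symm g ∈
      ((GD).quotientSubgroup ⊓ Subgroup.centralizer ({(GD).toAdelic d} : Set (GD).Adelic)).subgroupOf
        (Subgroup.centralizer ({(GD).toAdelic d} : Set (GD).Adelic)) ↔ g ∈ (GD).quotientSubgroup) :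
    ρF = Measure.map (subgroupCongrHomeomorph (centralizerEquivOfEqAlgebraMap K D hd).symm
      (GD).quotientSubgroup _ hmem (continuous_centralizerEquivOfEqAlgebraMap_symm K D hd)
      (continuous_centralizerEquivOfEqAlgebraMap K D hd)) ρ₀ := by
  have htop := units_centralizer_eq_top_of_eq_algebraMap K D hd
  set eL := subgroupCongrHomeomorph (centralizerEquivOfEqAlgebraMap K D hd).symm
      (GD).quotientSubgroup _ hmem (continuous_centralizerEquivOfEqAlgebraMap_symm K D hd)
      (continuous_centralizerEquivOfEqAlgebraMap K D hd) with heL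
  have hme := measurableEmbedding_subgroupInclusion ((GD).quotientSubgroup ⊓
    Subgroup.centralizer ({(GD).toAdelic d} : Set (GD).Adelic)) (GD).quotientSubgroup inf_le_left
    (hH.inter (isClosed_centralizer_singleton _))
  rw [hρF, hρH]
  ext S hS
  rw [Measure.map_apply (continuous_subgroupOfEquivOfLe_symm _ _ _).measurable hS,
    hme.comap_apply, Measure.map_apply eL.continuous.measurable hS]
  congr 1
  ext x
  simp only [Set.mem_image, Set.mem_preimage]
  constructor
  · rintro ⟨y, hy, rfl⟩
    convert hy using 1
    exact Subtype.ext (Subtype.ext rfl)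
  · intro hx
    have hxC : (x : (GD).Adelic) ∈ Subgroup.centralizer ({(GD).toAdelic d} : Set (GD).Adelic) := by
      rw [htop]; exact Subgroup.mem_top _
    refine ⟨⟨x, x.2, hxC⟩, ?_, Subtype.ext rfl⟩
    convert hx using 1
    exact Subtype.ext (Subtype.ext rfl)

omit [MeasurableSpace (AdelicGroupData.units K D).Adelic] [BorelSpace (AdelicGroupData.units K D).Adelic]
  [LocallyCompactSpace (AdelicGroupData.units K D).Adelic]
  [SecondCountableTopology (AdelicGroupData.units K D).Adelic] [T2Space (AdelicGroupData.units K D).Adelic] in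
/-- For central `γ`, `e⁻¹(g) ∈ H_γ ↔ g ∈ L` with `e = centralizerEquivOfEqAlgebraMap`,
`H_γ = (L ∩ C(γ)) ≤ C(γ)`. [folklore] -/
theorem centralizerEquivOfEqAlgebraMap_symm_mem_iff {d : Dˣ} {c : K}
    (hd : (d : D) = algebraMap K D c) (g : (GD).Adelic) :
    (centralizerEquivOfEqAlgebraMap K D hd).symm g ∈
      ((GD).quotientSubgroup ⊓ Subgroup.centralizer ({(GD).toAdelic d} : Set (GD).Adelic)).subgroupOf
        (Subgroup.centralizer ({(GD).toAdelic d} : Set (GD).Adelic)) ↔ g ∈ (GD).quotientSubgroup := by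
  rw [Subgroup.mem_subgroupOf, Subgroup.mem_inf]
  exact ⟨fun h => h.1, fun h => ⟨h, ((centralizerEquivOfEqAlgebraMap K D hd).symm g).2⟩⟩

/-- **The central terms of the `D^×` trace formula** (Gelbart (1975), p. 154: the term
`meas(Z'_𝔸 G'_F \ G'_𝔸) Φ'(e)` of (10.14); here one term for each central `γ ∈ Kˣ`, since no
central character is fixed). For a central class `γ = d ∈ Kˣ` the term
`vol(G_γ ⧸ H_γ) · ∫_{G ⧸ G_γ} Φ(y γ y⁻¹) d(ν/ν_γ)` of
`units_hasSum_norm_sq_integratedOperator_eq_tsum_covol_mul` (`G_γ = C(γ) = D_𝔸ˣ`,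
`H_γ = L ∩ C(γ) = L = ℝ_{>0} Dˣ`, `ν_γ` any Haar measure on `C(γ)`, `ρ_F` the transported
restriction of the Haar measure `ρ₀` of `L`) equals

  `vol(D_𝔸ˣ ⧸ ℝ_{>0} Dˣ; ν, ρ₀) · Φ(γ)`,

the covolume of `ℝ_{>0} Dˣ` in `D_𝔸ˣ` for `ν` and `ρ₀` (total mass of `quotientMeasure L ρ₀ ν`, Weil
constant one) times the value at `γ` — independently of the auxiliary `ν_γ`: the point `G ⧸ G_γ`
has mass the Haar scalar factor `c` of `ν` relative to `ν_γ`
(`units_quotientMeasure_centralizer_univ_of_eq_algebraMap`), the volume factor is the covolume for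
`ν_γ` (naturality, `quotientMeasure_univ_eq_of_mulEquiv`), and `ν/ρ₀ = c • (ν_γ/ρ₀)`
(`quotientMeasure_eq_smul_of_eq_smul`). [cite: Gelbart1975, (10.14) and p. 154] -/
theorem units_centralTerm_eq (hdiv : ∀ x : D, x ≠ 0 → IsUnit x) {d : Dˣ} {c : K}
    (hd : (d : D) = algebraMap K D c)
    [hH : IsClosed ((GD).quotientSubgroup : Set (GD).Adelic)]
    [hCcl : IsClosed ((Subgroup.centralizer ({(GD).toAdelic d} : Set (GD).Adelic) :
      Subgroup (GD).Adelic) : Set (GD).Adelic)]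
    [MeasurableSpace ((GD).Adelic ⧸ Subgroup.centralizer ({(GD).toAdelic d} : Set (GD).Adelic))]
    [BorelSpace ((GD).Adelic ⧸ Subgroup.centralizer ({(GD).toAdelic d} : Set (GD).Adelic))]
    [MeasurableSpace (↥(Subgroup.centralizer ({(GD).toAdelic d} : Set (GD).Adelic)) ⧸
      ((GD).quotientSubgroup ⊓ Subgroup.centralizer ({(GD).toAdelic d} : Set (GD).Adelic)).subgroupOf
        (Subgroup.centralizer ({(GD).toAdelic d} : Set (GD).Adelic)))]
    [BorelSpace (↥(Subgroup.centralizer ({(GD).toAdelic d} : Set (GD).Adelic)) ⧸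
      ((GD).quotientSubgroup ⊓ Subgroup.centralizer ({(GD).toAdelic d} : Set (GD).Adelic)).subgroupOf
        (Subgroup.centralizer ({(GD).toAdelic d} : Set (GD).Adelic)))]
    (νC : Measure (Subgroup.centralizer ({(GD).toAdelic d} : Set (GD).Adelic)))
    [IsHaarMeasure νC] [νC.IsMulRightInvariant] [νC.IsInvInvariant] [SFinite νC]
    (ρ₀ : Measure (GD).quotientSubgroup) [IsHaarMeasure ρ₀] [ρ₀.IsInvInvariant] [SFinite ρ₀]
    (ρH : Measure ↥((GD).quotientSubgroup ⊓ Subgroup.centralizer ({(GD).toAdelic d} : Set (GD).Adelic)))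
    (ρF : Measure ↥(((GD).quotientSubgroup ⊓ Subgroup.centralizer ({(GD).toAdelic d} :
      Set (GD).Adelic)).subgroupOf (Subgroup.centralizer ({(GD).toAdelic d} : Set (GD).Adelic))))
    [ρF.IsMulLeftInvariant] [IsFiniteMeasureOnCompacts ρF] [ρF.IsOpenPosMeasure] [ρF.IsInvInvariant]
    [SFinite ρF]
    (hρH : ρH = ρ₀.comap (Subgroup.inclusion inf_le_left))
    (hρF : ρF = Measure.map (Subgroup.subgroupOfEquivOfLe inf_le_right).symm ρH)
    (ν : Measure (GD).Adelic) [IsHaarMeasure ν] [ν.IsMulRightInvariant]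
    (Φ : (GD).Adelic → ℂ) :
    (((quotientMeasure (((GD).quotientSubgroup ⊓ Subgroup.centralizer ({(GD).toAdelic d} :
        Set (GD).Adelic)).subgroupOf (Subgroup.centralizer ({(GD).toAdelic d} : Set (GD).Adelic))) ρF
        (isClosed_subgroupOf _ _ (hH.inter hCcl)) νC Set.univ).toReal : ℝ) : ℂ) *
      ∫ y, descConj ((GD).toAdelic d) (Subgroup.centralizer ({(GD).toAdelic d} : Set (GD).Adelic))
        (mem_centralizer_singleton_comm _) Φ y
        ∂quotientMeasure (Subgroup.centralizer ({(GD).toAdelic d} : Set (GD).Adelic)) νC hCcl ν =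
    (((quotientMeasure (GD).quotientSubgroup ρ₀ hH ν Set.univ).toReal : ℝ) : ℂ) *
      Φ ((GD).toAdelic d) := by
  -- the Haar measure `ν' = ν_γ` viewed on `G`
  set e := centralizerEquivOfEqAlgebraMap K D hd with he
  have hec : Continuous e := continuous_centralizerEquivOfEqAlgebraMap K D hd
  have hesc : Continuous e.symm := continuous_centralizerEquivOfEqAlgebraMap_symm K D hd
  set ν' : Measure (GD).Adelic := Measure.map e νC with hν'
  haveI : IsHaarMeasure ν' := MulEquiv.isHaarMeasure_map νC e hec hesc
  haveI : ν'.IsMulRightInvariant := units_isMulRightInvariant_of_isHaarMeasure K D hdiv ν'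
  -- (1) the orbital integral is evaluation times the mass of the point
  have h1 := units_integral_descConj_of_eq_algebraMap K D hd
    (quotientMeasure (Subgroup.centralizer ({(GD).toAdelic d} : Set (GD).Adelic)) νC hCcl ν) Φ
  -- (2) the mass of the point is the Haar scalar factor
  have h2 := units_quotientMeasure_centralizer_univ_of_eq_algebraMap K D hd νC ν ν' hν'
  -- (3) the volume factor is the covolume for `ν'` (naturality along `e⁻¹ : G ≃* C(γ)`)
  haveI : IsClosed (((((GD).quotientSubgroup ⊓ Subgroup.centralizer ({(GD).toAdelic d} :
      Set (GD).Adelic)).subgroupOf (Subgroup.centralizer ({(GD).toAdelic d} : Set (GD).Adelic))) :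
        Subgroup (Subgroup.centralizer ({(GD).toAdelic d} : Set (GD).Adelic))) :
          Set (Subgroup.centralizer ({(GD).toAdelic d} : Set (GD).Adelic))) :=
    isClosed_subgroupOf _ _ (hH.inter hCcl)
  have hνC : νC = Measure.map e.symm ν' :=
    ((Homeomorph.mk e.toEquiv hec hesc).toMeasurableEquiv.map_symm_map (μ := νC)).symm
  have h3 := quotientMeasure_univ_eq_of_mulEquiv e.symm hesc hec (GD).quotientSubgroup
    (((GD).quotientSubgroup ⊓ Subgroup.centralizer ({(GD).toAdelic d} :
      Set (GD).Adelic)).subgroupOf (Subgroup.centralizer ({(GD).toAdelic d} : Set (GD).Adelic)))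
    (centralizerEquivOfEqAlgebraMap_symm_mem_iff K D hd) ρ₀ ρF ν' νC
    (units_restricted_eq_map_of_eq_algebraMap K D hd ρ₀ ρH ρF hρH hρF _) hνC
  -- (4) `ν/ρ₀ = c • (ν'/ρ₀)` with `c = haarScalarFactor ν ν'`
  have h4 := quotientMeasure_eq_smul_of_eq_smul (GD).quotientSubgroup ρ₀ ν ν'
    (isMulLeftInvariant_eq_smul ν ν')
  have h4' : quotientMeasure (GD).quotientSubgroup ρ₀ hH ν Set.univ =
      haarScalarFactor ν ν' * quotientMeasure (GD).quotientSubgroup ρ₀ hH ν' Set.univ := by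
    rw [h4, Measure.smul_apply, ENNReal.smul_def, smul_eq_mul]
  rw [h1, h2, h3, h4', Complex.real_smul, ← mul_assoc, ENNReal.toReal_mul, ENNReal.coe_toReal,
    Complex.ofReal_mul, mul_comm (((haarScalarFactor ν ν' : ℝ≥0) : ℝ) : ℂ)]

end Central

end Literature.NumberTheory.Automorphic
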